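import Summits.NavierStokesRegularity.NavierStokesRegularity.Theorems.PerpetualPumpThesisRestart

/-!
# Stub F (`besovFloorBound`) for `PerpetualPump.Thesis`, part IV: the restarted Duhamel identity

Support file (part 4 of the stub `besovFloorBound` of line `SketchIdeator2`, crux
stmt-NavierStokesRegularity-1832). Both a-priori estimates (A) (Besov) and (B) (tame `H¹⁰`) to
which part III (`…BesovFloorBoundReduction`) reduces the stub are statements about a mild solution
between two times `0 ≤ t₁ ≤ t < T`. In Tao's duality formulation (J. Amer. Math. Soc. 29 (2016),
§1.1 (1.15)) the mild identity is written from time `0`; this file records its **restarted form**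
for an ARBITRARY averaging datum `𝒜` (`F.pairing_eq_restart`, registered sub-goal
`stub_besovFloorBound_Duhamel`):

  `⟨u(t), w⟩ = ⟨e^{(t-t₁)Δ} u(t₁), w⟩ + ∫_{t₁}^{t} ⟨B̃(u(s),u(s)), e^{(t-s)Δ} w⟩ ds`, `w ∈ H¹⁰_df`,

obtained from the identities at `t` (tested against `w`) and at `t₁` (tested against
`e^{(t-t₁)Δ} w ∈ H¹⁰_df`) by the symmetry `⟨e^{τΔ}u, w⟩ = ⟨u, e^{τΔ}w⟩` (tree: `pairing_heat_left`),
the semigroup law (`G.heat_heat`) and the additivity of the Duhamel integral on `[0,t₁] ∪ [t₁,t]`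
(interval integrability from the `H¹⁰`-continuity of `u`, part II of stub U:
`U.intervalIntegrable_form_heat`).

## References

* T. Tao, J. Amer. Math. Soc. 29 (2016), 601–674, arXiv:1402.0290v3, §1.1 (1.15).
-/

noncomputable section

open MeasureTheory Set Filter Topology
open scoped ENNReal NNReal

set_option linter.dupNamespace false

namespace Summit.NavierStokesRegularity.NavierStokesRegularity.Theorems.PerpetualPumpThesis.F

open Literature.Analysis.FluidPDE Literature.Analysis.FluidPDE.Tao2016
open Literature.Analysis.FunctionSpaces (eFourierSobolevNorm)

/-- **The restarted Duhamel identity** of a mild `H¹⁰_df` solution `u` of the averaged equation of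
`𝒜` on `[0,T)`: for `0 ≤ t₁ ≤ t < T` and every `w ∈ H¹⁰_df`,
`⟨u(t), w⟩ = ⟨e^{(t-t₁)Δ} u(t₁), w⟩ + ∫_{t₁}^{t} ⟨B̃(u(s),u(s)), e^{(t-s)Δ} w⟩ ds`. -/
theorem pairing_eq_restart (𝒜 : AveragingDatum) {a : L2C} {T : ℝ} {u : ℝ → L2C}
    (hu : IsMildSolutionFor 𝒜.form a (Ico 0 T) u) {t₁ t : ℝ} (ht₁ : 0 ≤ t₁) (ht₁t : t₁ ≤ t)
    (htT : t < T) {w : L2C} (hw : MemH10df w) :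
    pairing (u t) w =
      pairing (heat (t - t₁) (u t₁)) w +
        ∫ s in t₁..t, 𝒜.form (u s) (u s) (heat (t - s) w) := by
  have ht : t ∈ Ico 0 T := ⟨ht₁.trans ht₁t, htT⟩
  have ht₁I : t₁ ∈ Ico 0 T := ⟨ht₁, ht₁t.trans_lt htT⟩
  have hσ : 0 ≤ t - t₁ := sub_nonneg.2 ht₁t
  -- interval integrability of the Duhamel integrand on `[0, t₁]` and `[t₁, t]`
  have hcont : ContinuousInH10On (Icc 0 t) u := hu.2.1.mono (Icc_subset_Ico_right htT)
  have hfin : ∀ s ∈ Icc 0 t, eFourierSobolevNorm 10 (u s) < ⊤ := fun s hs =>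
    (hu.1 s ⟨hs.1, hs.2.trans_lt htT⟩).1
  obtain ⟨M, hM⟩ := G.exists_H10_le_ofReal hcont hfin
  have hint₁ : IntervalIntegrable (fun s => 𝒜.form (u s) (u s) (heat (t - s) w)) volume 0 t₁ :=
    U.intervalIntegrable_form_heat 𝒜 hcont hM w t
      (by rw [uIcc_of_le ht₁]; exact Icc_subset_Icc_right ht₁t)
  have hint₂ : IntervalIntegrable (fun s => 𝒜.form (u s) (u s) (heat (t - s) w)) volume t₁ t :=
    U.intervalIntegrable_form_heat 𝒜 hcont hM w t
      (by rw [uIcc_of_le ht₁t]; exact Icc_subset_Icc_left ht₁)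
  -- the identities at `t` (against `w`) and at `t₁` (against `e^{(t-t₁)Δ} w`)
  have et := hu.2.2 t ht w hw
  have et₁ := hu.2.2 t₁ ht₁I (heat (t - t₁) w) (hw.heat _)
  -- recombination of the free terms and of the propagators inside the integral
  have efree : pairing (heat t₁ a) (heat (t - t₁) w) = pairing (heat t a) w := by
    rw [← pairing_heat_left, G.heat_heat hσ ht₁, sub_add_cancel]
  have eI : ∫ s in (0 : ℝ)..t₁, 𝒜.form (u s) (u s) (heat (t₁ - s) (heat (t - t₁) w)) =
      ∫ s in (0 : ℝ)..t₁, 𝒜.form (u s) (u s) (heat (t - s) w) := by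
    refine intervalIntegral.integral_congr fun s hs => ?_
    rw [uIcc_of_le ht₁] at hs
    rw [G.heat_heat (sub_nonneg.2 hs.2) hσ, show t₁ - s + (t - t₁) = t - s by ring]
  rw [pairing_heat_left, et₁, efree, eI, et, add_assoc,
    intervalIntegral.integral_add_adjacent_intervals hint₁ hint₂]

end Summit.NavierStokesRegularity.NavierStokesRegularity.Theorems.PerpetualPumpThesis.F

namespace Summit.NavierStokesRegularity.NavierStokesRegularity.Theorems.PerpetualPumpThesis

open Literature.Analysis.FluidPDE Literature.Analysis.FluidPDE.Tao2016
open Literature.Analysis.FunctionSpaces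

/-- **Part Duhamel of stub F (registered sub-goal `stub_besovFloorBound_Duhamel`)**: the restarted
Duhamel identity of a mild `H¹⁰_df` solution of the averaged equation of an arbitrary averaging
datum `𝒜` on `[0,T)`: for `0 ≤ t₁ ≤ t < T` and `w ∈ H¹⁰_df`,
`⟨u(t), w⟩ = ⟨e^{(t-t₁)Δ} u(t₁), w⟩ + ∫_{t₁}^{t} ⟨B̃(u(s),u(s)), e^{(t-s)Δ} w⟩ ds`. -/
theorem stub_besovFloorBound_Duhamel : ∀ (𝒜 : AveragingDatum) (a : L2C) (T : ℝ) (u : ℝ → L2C), IsMildSolutionFor 𝒜.form a (Ico 0 T) u → ∀ t₁ t : ℝ, 0 ≤ t₁ → t₁ ≤ t → t < T → ∀ w : L2C, MemH10df w → pairing (u t) w = pairing (heat (t - t₁) (u t₁)) w + ∫ s in t₁..t, 𝒜.form (u s) (u s) (heat (t - s) w) :=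
  fun 𝒜 _ _ _ hu _ _ ht₁ ht₁t htT _ hw => F.pairing_eq_restart 𝒜 hu ht₁ ht₁t htT hw

end Summit.NavierStokesRegularity.NavierStokesRegularity.Theorems.PerpetualPumpThesis
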